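import Literature.Probability.Percolation.OneArmHittingPDE
import Literature.Analysis.Complex.KoebeCovering
import HarnessLib

/-!
# The one-arm exponent: discharging the Koebe input (proofs only)

Topic `Literature/Probability/Percolation`; family `crit-perc`. Def-free companion of
`OneArmHittingPDE.lean`, which proves LSW Theorem 1.2 (and hence, with
`OneArmScalingLimit.lean`, `OneArmLSW.lean`, `TriAnnulusCircuit.lean`, the one-arm exponent
`Literature.Probability.Percolation.oneArm_exponent`, LSW Thm. 1.1) from the existence of the
scaling limit (LSW §2, p. 3; an explicit hypothesis), the radial-`SLE₆` PDE fact
`LawlerSchrammWerner2002_hittingPDE` (LSW Lemma 2.2, (2.3), Lemma 2.3) and Koebe covering with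
an arbitrary constant (`Literature.KoebeCovering c`). Koebe covering with the explicit constant
`1/(128π)` being a theorem (`Complex.ball_subset_image_of_injOn`,
`Literature/Analysis/Complex/KoebeCovering.lean`, via Bloch–Landau), the Koebe input is
discharged here:

* `koebeCovering_const : KoebeCovering (1/(128π))`;
* `LawlerSchrammWerner2002_scalingLimitExponent_of_hittingPDE` — LSW Thm. 1.2 from the PDE fact
  alone;
* `oneArm_exponent_of_scalingLimit_of_hittingPDE` — the one-arm exponent from exactly the two
  continuum facts: existence of the scaling limit (LSW §2 p. 3; Smirnov 2001, Camia–Newman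
  2006) and LSW Lemma 2.2/(2.3)/Lemma 2.3 about it. Everything else in LSW's proof of
  Theorem 1.1 — RSW, §3, (3.1), (2.1), (2.17) and the deduction of Theorem 1.2 — is proved in
  this library.

## References

* G. F. Lawler, O. Schramm, W. Werner, *One-arm exponent for critical 2D percolation*, Electron.
  J. Probab. 7 (2002), no. 2, Thms. 1.1–1.2, §2 [LawlerSchrammWernerEJP2002].
* J. B. Conway, *Functions of One Complex Variable I* (1978), Ch. XII §1 [Conway1978].
-/

noncomputable section

open Metric Set

namespace Literature.Probability.Percolation

/-- **Koebe covering with constant `1/(128π)` holds** (from `Complex.ball_subset_image_of_injOn`,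
Bloch–Landau). [cite: Conway1978, Ch. XII Thm. 1.4] -/
theorem koebeCovering_const : Literature.Analysis.Complex.KoebeCovering (1 / (128 * Real.pi)) := by
  intro f hf hinj
  have := Complex.ball_subset_image_of_injOn hf hinj
  rwa [div_eq_mul_one_div, mul_comm] at this

/-- **LSW Theorem 1.2 from Lemma 2.2, (2.3) and Lemma 2.3 alone**: the maximum principle
(2.17), the passage (2.1) via the conformal radius, and Koebe covering are all theorems of this
library. [cite: LawlerSchrammWernerEJP2002, Thm. 1.2 and its proof (pp. 2–8)] -/
theorem LawlerSchrammWerner2002_scalingLimitExponent_of_hittingPDE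
    (h : LawlerSchrammWerner2002_hittingPDE) : LawlerSchrammWerner2002_scalingLimitExponent :=
  LawlerSchrammWerner2002_thm_1_2_of_koebeCovering koebeCovering_const (by positivity) h

/-- **The one-arm exponent from the two continuum facts**: `P[0 ↔ ∂Λ_n] = n^{-5/48 + o(1)}`
(LSW Thm. 1.1, `oneArm_exponent`) follows from the existence of the scaling limit
(hypothesis `h₁`, LSW §2, p. 3) and the radial-`SLE₆` PDE facts about it
(`LawlerSchrammWerner2002_hittingPDE`).
[cite: LawlerSchrammWernerEJP2002, Thm. 1.1, Thm. 1.2, §2–§3] -/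
theorem oneArm_exponent_of_scalingLimit_of_hittingPDE
    (h₁ : ∃ ν : MeasureTheory.ProbabilityMeasure (TopologicalSpace.NonemptyCompacts ℂ),
      Filter.Tendsto lswLaw Filter.atTop (nhds ν))
    (h₂ : LawlerSchrammWerner2002_hittingPDE) : oneArm_exponent :=
  oneArm_exponent_of_koebeCovering h₁ h₂ koebeCovering_const (by positivity)

end Literature.Probability.Percolation
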